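import Literature.NumberTheory.EllipticCurves.KolyvaginShaIndexBound
import HarnessLib

/-!
# Kolyvagin's `Ш(E/K)`-index bound under IRREDUCIBILITY of `E[p]` only (Kolyvagin 1990 Cor. 13 as
# restated by Matar–Nekovář 2019, Thm. 0.3, with its condition (a) discharged by Matar–Nekovář
# Cor. 5.21 / Prop. 5.26): `ord_p #Ш(E/K) ≤ 2 · ord_p [E(K) : ℤ y_K]`, CM allowed

A. Matar, J. Nekovář, *Kolyvagin's result on the vanishing of `Ш(E/K)[p^∞]` and its consequences
for anticyclotomic Iwasawa theory*, J. Théor. Nombres Bordeaux **31** (2019), no. 2, 455–501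
(doi:10.5802/jtnb.1091; held as `paper:doi-10-5802-jtnb-1091`, READ 2026-08-20 at the locators
below; the *Correction*, JTNB **33** (2021) 627–628, concerns Thm. 6.7 (2) and Thm. 6.10 only).
PUBLISHED, refereed. Sibling of `ShaVanishing.lean` (Thm. 6.7 (1): the case `m₀ = 0`) and of the
SURJECTIVE-image fact `Kolyvagin1990_padicValNat_card_sha_le` (`KolyvaginShaIndexBound.lean`,
McCallum 1991 §1, `R = ℤ`), whose binders this file copies with "`ρ̄_{E,p}` onto" replaced by
"`E[p]` an irreducible `𝔽_p[G_ℚ]`-module" and with Kolyvagin's standing hypothesis `D_K ≠ −3, −4`.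

HONEST FRAMING (BSD rank-`≤ 1` residual cell `b2b-bsdres`, run/shared/lean/b2b/bsd-rank1-residual/;
unit `b2b-bsdres-x1b`, X12 prover owner, gen 9): the cell deletes the COMBINATION-SHAPED residual
classes of the rank-`≤ 1` BSD formula STRICTLY from published theorems and TYPES the remainder; this
is not "finishing BSD". This file vendors ONE published statement as a named fact (`def … : Prop`,
nothing asserted; D-0014). Its consumer is the class-level UPPER HALF of `BSD(E,p)` on the X12
inert-bad core (CM, analytic rank one, `p ≥ 5`, `p ∣ N`, `p` unramified in the CM field), where
`ρ̄_{E,p}` is never surjective but `E[p]` IS irreducible (`Summits/…/X12/CMIrreducible.lean`).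

## The statements in print (verbatim)

**0.3. Theorem** (p. 456) "(Kolyvagin, special case of [18, Cor. 13]). Assume that `D_K ≠ −3, −4`
and that `p ≠ 2` is a prime number satisfying the following conditions.
(a) `∀ n₁, n₂ ≥ 0  H¹(K(E[p^{n₁+n₂}])/K, E[p^{n₁}]) = 0`.
(b) Neither of the `(±1)`-eigenspaces `E[p]^±` for the action of complex conjugation is stable under
the action of `G_ℚ := Gal(ℚ̄/ℚ)`. Equivalently, the (mod `p`) Galois representation
`ρ̄_{E,p} : G_ℚ ⟶ Aut_{𝔽_p}(E[p]) ≃ GL₂(𝔽_p)` is irreducible.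
(c) `E(K)[p] = 0`.
If `y_K ∉ E(K)_{tors}`, then `E(K)/ℤy_K` is finite and `p^{m₀} Ш(E/K)[p^∞] = 0`,
`#Ш(E/K)[p^∞]` divides `p^{2m₀}`, where `m₀ := sup{m ≥ 0 | y_K ∈ p^m E(K)}` (thus
`E(K) ⊗ ℤ_p ≃ ℤ_p` and `p^{m₀} = [E(K) ⊗ ℤ_p : ℤ_p(y_K ⊗ 1)]`)." Here ([18] = V. A. Kolyvagin,
*Euler systems*, The Grothendieck Festschrift II, Progr. Math. 87 (1990) 435–483) and (§0.1, p. 455)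
"`E` an elliptic curve over `ℚ` of conductor `N` and `K` an imaginary quadratic field of
discriminant `D_K` in which all primes dividing `N` split. Fix a modular parameterisation
`φ : X₀(N) ⟶ E` and an ideal `𝒩 ⊂ 𝒪_K` such that `𝒪_K/𝒩 ≃ ℤ/Nℤ`. The basic Heegner point
`y_K ∈ E(K)` attached to these data is, by definition, the trace `y_K := Tr_{H₁/K}(y₁)`".

**0.4.** (p. 456) "For `p ≠ 2`, the assumption (b) in Theorem 0.3 implies (c)."

**0.11.** (p. 457) "[Lawson–Wuthrich's] results imply that the condition (a) in Theorem 0.3 (for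
`p ≠ 2`) is always satisfied if `ρ̄_{E,p}` is irreducible. Consequently, the conclusions of
Theorems 0.3 and 0.7 hold (for `D_K ≠ −3, −4`) if `ρ̄_{E,p}` is irreducible and `p ≠ 2`."

**5.21. Corollary** (pp. 490–491; situation of §5.19 with `M = ℚ`, §5.22: `B = E` an elliptic curve
over a field `K` of characteristic `≠ p`, `p ≠ 2`, `k = 𝔽_p`). "Assume that `B[p]` is an
irreducible `k[G_K]`-module. If at least one of the conditions (a)–(g′) below holds, then
`∀ m₁ ≥ m₂ ≥ 1  H¹(K(B[p^{m₁}])/K, B[p^{m₂}]) = 0`. … (e′) `K` is an imaginary quadratic field and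
`k = 𝔽_p`."

**5.26. Proposition** (p. 492). "Let `E` be an elliptic curve over `ℚ` of conductor `N` and `K` a
quadratic field of discriminant `D_K` relatively prime to `N`. Let `ρ := ρ̄_{E,p}`, for a prime
number `p ≠ 2`. … (2) If `ρ` is irreducible, so is `ρ|_{G_K}`."

So, for `p ≠ 2` and `E[p]` an irreducible `𝔽_p[G_ℚ]`-module: (b) holds by definition, (c) by 0.4,
and (a) by Prop. 5.26 (2) (the Heegner hypothesis gives `(D_K, N) = 1`) and Cor. 5.21 (e′) with
`(m₁, m₂) = (n₁ + n₂, n₁)` (the cases `n₁ = 0` being trivial) — which is the sentence of §0.11.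

## What is vendored (never stronger than print)

`thm03_padicValNat_card_sha_le_of_irreducible`: for `E/ℚ` (model `W`), `K` imaginary quadratic with
the Heegner hypothesis for the level `N` and `d_K ≠ −3, −4`, `P = y_K ∈ E(K)` a basic Heegner point
of level `N` (`IsHeegnerPoint N W K P`, as in both siblings) of infinite order, `p ≠ 2` prime with
`E[p]` irreducible (`HasIrreducibleModPGaloisRep`): `ord_p #Ш(E/K) ≤ 2 · ord_p [E(K) : ℤ P]`, in
the sibling's currency (`Nat.card` of `(W.baseChange K).sha`, `AddSubgroup.index` of `ℤP`).
FAITHFULNESS: under the printed conclusions `E(K)/ℤy_K` is finite, so `E(K) = ℤg ⊕ T` with `T`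
finite, `y_K = n·g + t`, `[E(K) : ℤ y_K] = n · #T` and `p^{m₀} = [E(K) ⊗ ℤ_p : ℤ_p(y_K ⊗ 1)] =
p^{ord_p n} · #T[p^∞]`, whence `ord_p [E(K) : ℤ y_K] = m₀` EXACTLY and "`#Ш(E/K)[p^∞] ∣ p^{2m₀}`"
is `ord_p #Ш(E/K) ≤ 2·ord_p [E(K) : ℤ y_K]` (`Ш(E/K)` finite by Kolyvagin's Thm. A = the tree fact
`kolyvagin`; Mathlib's junk value `0` for an infinite cardinal / index only weakens the inequality,
exactly as discussed in `KolyvaginShaIndexBound.lean`). The clause `p^{m₀} Ш(E/K)[p^∞] = 0` and the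
structure theorem 0.7 are NOT transcribed. No surjectivity, no `p ∤ D_K`, no reduction-type
hypothesis at `p` (`p ∣ N`, `p² ∣ N` allowed), no non-CM hypothesis — CM curves at primes
unramified in the CM field are the intended consumers.

REFEREE FLAGS (travel with the fact): `MN19-0.11-composite` (the irreducible-image form is the
authors' §0.11 sentence assembling their Thm. 0.3 = Kolyvagin Cor. 13 with their Cor. 5.21 (e′),
Prop. 5.26 (2) and §0.4; the ingredients are in-body, the assembly is stated in the introduction);
`Kolyvagin1990-Cor13-primary-unread` (Progr. Math. 87 not held; read through Matar–Nekovář's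
restatement, as the surjective sibling reads Thm. A through McCallum/Gross). CAUTION recorded for the
cell (not used here): §0.10–0.11 (p. 457) state that GJPST 2009 Thm. 3.7 "remains unproved" and
that "the claims made in [Lawson–Wuthrich 2016, Thm. 14] about the validity of Theorem 0.3 in
situations when (a) holds but `ρ̄_{E,p}` is reducible are unjustified" — this file uses the
IRREDUCIBLE case only. Size XL (Kolyvagin's Euler system + the cohomological vanishing of §5); no
`_holds`.

Also proved here: `padicValNat_card_sha_eq_zero_of_not_dvd_index_of_irreducible` — the certificate
case `p ∤ [E(K) : ℤ P]` ⇒ `ord_p #Ш(E/K) = 0` (consistent with Thm. 6.7 (1), `ShaVanishing.lean`).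
-/

noncomputable section

open scoped Classical

open WeierstrassCurve

universe u

namespace Literature.NumberTheory.EllipticCurves.MatarNekovar2019

section Statement

variable (N : ℕ) [NeZero N] (W : WeierstrassCurve ℚ) (K : Type u) [Field K] [NumberField K]

/-- **Kolyvagin 1990 Cor. 13 under irreducibility = Matar–Nekovář 2019 Thm. 0.3 + §0.4 + §0.11 +
Cor. 5.21 (e′) + Prop. 5.26 (2)** (JTNB 31 (2019) pp. 456–457, 490–492): "Assume that `D_K ≠ −3, −4`
and that `p ≠ 2` is a prime number satisfying (a) `∀ n₁, n₂ ≥ 0 H¹(K(E[p^{n₁+n₂}])/K, E[p^{n₁}]) = 0`,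
(b) `ρ̄_{E,p}` is irreducible, (c) `E(K)[p] = 0`. If `y_K ∉ E(K)_{tors}`, then `E(K)/ℤy_K` is finite
and `p^{m₀} Ш(E/K)[p^∞] = 0`, `#Ш(E/K)[p^∞]` divides `p^{2m₀}`, where … `p^{m₀} =
[E(K) ⊗ ℤ_p : ℤ_p(y_K ⊗ 1)]`" (Thm. 0.3), together with "For `p ≠ 2`, the assumption (b) implies (c)"
(§0.4) and "the condition (a) in Theorem 0.3 (for `p ≠ 2`) is always satisfied if `ρ̄_{E,p}` is
irreducible. Consequently, the conclusions of Theorems 0.3 and 0.7 hold (for `D_K ≠ −3, −4`) if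
`ρ̄_{E,p}` is irreducible and `p ≠ 2`" (§0.11; in-body: Cor. 5.21 (e′) "`K` is an imaginary quadratic
field and `k = 𝔽_p`" and Prop. 5.26 (2) "If `ρ` is irreducible, so is `ρ|_{G_K}`", `(D_K, N) = 1`).
Vendored (Ш-clause only, sibling currency of `Kolyvagin1990_padicValNat_card_sha_le`): for `E/ℚ`
(model `W`), `K` imaginary quadratic satisfying the Heegner hypothesis for the level `N` with
`d_K ≠ −3` and `d_K ≠ −4`, a basic Heegner point `P = y_K ∈ E(K)` of level `N` of infinite order, and
a prime `p ≠ 2` with `E[p]` an IRREDUCIBLE `𝔽_p[G_ℚ]`-module: `ord_p #Ш(E/K) ≤ 2 · ord_p [E(K) : ℤP]`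
(`ord_p [E(K) : ℤ y_K] = m₀` exactly, see the module docstring). No surjectivity, no `p ∤ D_K`, no
hypothesis on the reduction of `E` at `p`, no non-CM hypothesis. Named fact (D-0014): nothing
asserted; users take `(h : thm03_padicValNat_card_sha_le_of_irreducible N W K)`. Flags
`MN19-0.11-composite`, `Kolyvagin1990-Cor13-primary-unread`. Size XL; no `_holds`.
[cite: MatarNekovar2019, Thm. 0.3 (p. 456), §0.4 (p. 456), §0.11 (p. 457), Cor. 5.21 (e′) (pp. 490–491), Prop. 5.26 (2) (p. 492), §0.1 and §6.1 (pp. 455, 497: y_K)]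
[cite: KolyvaginEulerSystems1990, Cor. 13 (and Thm. A)] -/
def thm03_padicValNat_card_sha_le_of_irreducible : Prop :=
  ∀ [W.IsElliptic] (_hK : IsImaginaryQuadratic K) (_hH : SatisfiesHeegnerHypothesis N K)
    (_hD3 : NumberField.discr K ≠ -3) (_hD4 : NumberField.discr K ≠ -4)
    {P : (W.baseChange K).toAffine.Point} (_hP : IsHeegnerPoint N W K P)
    (_hnt : ¬ IsOfFinAddOrder P) {p : ℕ} (_hp : p.Prime) (_hp2 : p ≠ 2)
    (_hirr : W.HasIrreducibleModPGaloisRep p),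
    padicValNat p (Nat.card ((W.baseChange K).sha)) ≤
      2 * padicValNat p (AddSubgroup.zmultiples P).index

end Statement

/-! ### API: the certificate case `p ∤ [E(K) : ℤ y_K]` -/

section API

variable {N : ℕ} [NeZero N] {W : WeierstrassCurve ℚ} {K : Type u} [Field K] [NumberField K]

/-- **The case `p ∤ I_K` of the irreducible-image bound**: `ord_p #Ш(E/K) = 0` — the numerical
shadow of Thm. 6.7 (1) (`ShaVanishing.lean`: `Ш(E/K)[p^∞] = 0`).
[cite: MatarNekovar2019, Thm. 0.3 (p. 456) and Thm. 6.7 (1) (p. 498)] -/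
theorem padicValNat_card_sha_eq_zero_of_not_dvd_index_of_irreducible
    (h : thm03_padicValNat_card_sha_le_of_irreducible N W K) [W.IsElliptic]
    (hK : IsImaginaryQuadratic K) (hH : SatisfiesHeegnerHypothesis N K)
    (hD3 : NumberField.discr K ≠ -3) (hD4 : NumberField.discr K ≠ -4)
    {P : (W.baseChange K).toAffine.Point} (hP : IsHeegnerPoint N W K P)
    (hnt : ¬ IsOfFinAddOrder P) {p : ℕ} (hp : p.Prime) (hp2 : p ≠ 2)
    (hirr : W.HasIrreducibleModPGaloisRep p) (hI : ¬ p ∣ (AddSubgroup.zmultiples P).index) :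
    padicValNat p (Nat.card ((W.baseChange K).sha)) = 0 := by
  have hle := h hK hH hD3 hD4 hP hnt hp hp2 hirr
  rw [padicValNat.eq_zero_of_not_dvd hI, mul_zero] at hle
  exact Nat.le_zero.mp hle

/-- **From `|d_K| > 4`** (the form in which Friedberg–Hoffstein / the cell's twist supply delivers
the Heegner field): `d_K ≠ −3` and `d_K ≠ −4`, so the bound applies. [cite: MatarNekovar2019, Thm. 0.3 (p. 456)] -/
theorem padicValNat_card_sha_le_of_natAbs_discr_gt_four
    (h : thm03_padicValNat_card_sha_le_of_irreducible N W K) [W.IsElliptic]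
    (hK : IsImaginaryQuadratic K) (hH : SatisfiesHeegnerHypothesis N K)
    (hdisc : 4 < (NumberField.discr K).natAbs)
    {P : (W.baseChange K).toAffine.Point} (hP : IsHeegnerPoint N W K P)
    (hnt : ¬ IsOfFinAddOrder P) {p : ℕ} (hp : p.Prime) (hp2 : p ≠ 2)
    (hirr : W.HasIrreducibleModPGaloisRep p) :
    padicValNat p (Nat.card ((W.baseChange K).sha)) ≤
      2 * padicValNat p (AddSubgroup.zmultiples P).index := by
  refine h hK hH ?_ ?_ hP hnt hp hp2 hirr <;> intro hd <;> rw [hd] at hdisc <;> simp at hdisc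

end API

end Literature.NumberTheory.EllipticCurves.MatarNekovar2019

end
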